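import Literature.Analysis.FluidPDE.ClassicalSuitableRegionEnergy
import Literature.Analysis.FluidPDE.DipolePotentialFlow
import HarnessLib

/-!
# The potential flow `u = c√(−t) ∇Γ(x)` on the parabolic exterior `{R√(−t) < |x|}`: a Type-I classical
# Navier–Stokes flow with vanishing final-time trace — backward NON-uniqueness from the "scar" off the core

Analysis/FluidPDE proofs-layer file (theorems + data definitions, no new `Prop` facts) over the accepted
`IsSuitableWeakSolutionOn`, `HasWeakSpatialGradientOn` (`SuitableWeak.lean`), `IsClassicalNSSolutionOnRegion` and
the bridge `IsClassicalNSSolutionOnRegion.isSuitableWeakSolutionOn_of_subset` (`ClassicalSuitableRegionEnergy.lean`),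
`newtonKernel` (`NewtonKernel.lean`) and the dipole calculus of `DipolePotentialFlow.lean`.

Potential flows `u = a(t)∇h(x)`, `h` harmonic, `p = −a′h − a²|∇h|²/2` solve Navier–Stokes for every amplitude `a`
(Serrin 1962); with `h = Γ = −(4π|x|)⁻¹` and the SCALE-INVARIANT amplitude `a(t) = c√(−t)` the flow is, in Leray's
similarity variables `y = x/√(−t)`, `s = −log(−t)`, the STATIONARY profile `U(y) = c∇Γ(y) = c y/(4π|y|³)` —
`|U| = O(|y|⁻²)`, `|∇U| = O(|y|⁻³)` — on the exterior cylinder `{|y| > R} × ℝ_s`, i.e. on the parabolic exterior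
`Ω_R = {(t,x) : t < 0, R√(−t) < |x|}` in physical variables:

* `parabolicExterior R`, `parabolicExteriorOpens R` — the region (open, non-empty, `x ≠ 0` on it);
* `sqrtAmp c`, `sqrtAmpDeriv c` — `a(t) = c√(−t)`, `a′(t) = −c/(2√(−t))`;
* `dipoleFlow c`, `dipoleFlowPressure c` — `u = a(t) • dipole x`, `p = −a′Γ − a²|dipole|²/2`;
* `dipoleFlow_isClassical`, `dipoleFlow_isSuitable` — classical, hence suitable weak, Navier–Stokes solution
  (`ν = 1`, `f = 0`) on `Ω_R` (`R ≥ 0`);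
* `dipoleFlow_typeI_abs` — the space–time Type-I bound `‖u(t,x)‖ ≤ |c|/(‖x‖ + √(−t))` on `Ω_R`, `R ≥ 1`
  (Type-I constant `|c|`, arbitrarily small);
* `tendsto_eLpNorm_dipoleFlow` — its final-time trace off the origin VANISHES: `ess sup_{(−δ,0)×K} ‖u‖ → 0` for
  every compact `K ∌ 0` (same "scar" as the zero flow);
* `exists_sameScar_typeI_not_aeEq_parabolicExterior` — **for every `R ≥ 1` and every `C > 0` there are two
  suitable weak solutions on `Ω_R` (`0` and `dipoleFlow C`) with the Type-I bound (constant `C`), the same scar,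
  NOT a.e. equal**: backward uniqueness from the final-time trace fails off the parabolic core, with no smallness
  threshold.

Written by the disprover of route item `ScarRigidity` (stmt-NavierStokesRegularity-11717, route RellichScar): the
witness is the `l = 0`, `μ = 0` member of the exterior pressure modes `e^{iμs}∇(r^{−l−1}Y_lm)` of the linearised
profile system, and kills the route's foreseen exterior lemma `LinearRellichExterior` as worded together with its
nonlinear analogue — the equations across the core `{|y| ≤ R}` (or a flux condition at the inner boundary) are
load-bearing for any scar-rigidity statement.

## References

* J. Serrin, *On the interior regularity of weak solutions of the Navier–Stokes equations*, Arch. Rational Mech.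
  Anal. 9 (1962) 187–195 (the example `u = a(t)∇h`). [Serrin1962]
* J. Leray, Acta Math. 63 (1934), (3.13)–(3.14) (backward similarity variables). [Leray1934]
* D. Gilbarg, N. Trudinger, *Elliptic PDE of Second Order*, (2.12)–(2.13) (`Γ`, `DΓ`). [GilbargTrudinger2001]
-/

noncomputable section

open Set Filter Function MeasureTheory Metric TopologicalSpace
open scoped Topology ENNReal NNReal InnerProductSpace RealInnerProductSpace Laplacian

namespace Literature.Analysis.FluidPDE

/-- Local notation for physical space `ℝ³ = EuclideanSpace ℝ (Fin 3)`. -/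
local notation "ℝ³" => EuclideanSpace ℝ (Fin 3)

/-! ## A measure-theoretic criterion -/

/-- A.E.-DISTINCTNESS CRITERION: two functions differing at every point of a non-empty open subset of `S`
are not a.e. equal on `S`. [folklore] -/
private theorem not_aeEq_restrict_of_ne_on_open {f g : ℝ × ℝ³ → ℝ³} {S U : Set (ℝ × ℝ³)} (hU : IsOpen U)
    (hUne : U.Nonempty) (hUS : U ⊆ S) (hne : ∀ z ∈ U, f z ≠ g z) :
    ¬ (f =ᵐ[volume.restrict S] g) := by
  intro h
  have hUpos : 0 < volume.restrict S U := by
    rw [Measure.restrict_apply hU.measurableSet, inter_eq_left.2 hUS]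
    exact hU.measure_pos volume hUne
  have hnull : volume.restrict S U = 0 :=
    measure_mono_null (fun z hz => by simpa using hne z hz) (ae_iff.1 h)
  exact hUpos.ne' hnull


/-! ## The parabolic exterior region and the flow `u = c √(−t) ∇Γ(x)` -/

/-- PARABOLIC EXTERIOR REGION `Ω_R = {(t, x) : t < 0, R√(−t) < ‖x‖}`; in Leray's similarity variables
`y = x/√(−t)`, `s = −log(−t)` this is the exterior cylinder `{|y| > R} × ℝ_s`. [folklore] -/
def parabolicExterior (R : ℝ) : Set (ℝ × ℝ³) := {z | z.1 < 0 ∧ R * Real.sqrt (-z.1) < ‖z.2‖}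

/-- `Ω_R` is open. [folklore] -/
theorem isOpen_parabolicExterior (R : ℝ) : IsOpen (parabolicExterior R) :=
  (isOpen_lt continuous_fst continuous_const).inter
    (isOpen_lt (continuous_const.mul continuous_fst.neg.sqrt) continuous_snd.norm)

/-- `Ω_R` as an open set of space–time. [folklore] -/
def parabolicExteriorOpens (R : ℝ) : Opens (ℝ × ℝ³) := ⟨parabolicExterior R, isOpen_parabolicExterior R⟩

/-- Points of `Ω_R` (`R ≥ 0`) have `x ≠ 0`. [folklore] -/
theorem snd_ne_zero_of_mem_parabolicExterior {R : ℝ} (hR : 0 ≤ R) {z : ℝ × ℝ³}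
    (hz : z ∈ parabolicExterior R) : z.2 ≠ 0 := by
  have h : R * Real.sqrt (-z.1) < ‖z.2‖ := hz.2
  have h0 : 0 ≤ R * Real.sqrt (-z.1) := mul_nonneg hR (Real.sqrt_nonneg _)
  exact norm_pos_iff.1 (h0.trans_lt h)

/-- `Ω_R` is non-empty: it contains `(−1, x)` with `‖x‖ = |R| + 1`. [folklore] -/
theorem parabolicExterior_nonempty (R : ℝ) : (parabolicExterior R).Nonempty := by
  obtain ⟨e, he⟩ := exists_norm_eq ℝ³ (show (0 : ℝ) ≤ |R| + 1 by positivity)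
  refine ⟨((-1 : ℝ), e), by norm_num, ?_⟩
  show R * Real.sqrt (-(-1 : ℝ)) < ‖e‖
  rw [neg_neg, Real.sqrt_one, mul_one, he]
  linarith [le_abs_self R]

/-- Amplitude `a(t) = c√(−t)`. [folklore] -/
def sqrtAmp (c : ℝ) (t : ℝ) : ℝ := c * Real.sqrt (-t)

/-- Its derivative `a'(t) = −c/(2√(−t))` for `t < 0`. [folklore] -/
def sqrtAmpDeriv (c : ℝ) (t : ℝ) : ℝ := -(c / (2 * Real.sqrt (-t)))

/-- `a'(t) = −c/(2√(−t))` for `t < 0`. [folklore] -/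
theorem hasDerivAt_sqrtAmp (c : ℝ) {t : ℝ} (ht : t < 0) : HasDerivAt (sqrtAmp c) (sqrtAmpDeriv c t) t := by
  have h1 : HasDerivAt (fun s : ℝ => Real.sqrt (-s)) (1 / (2 * Real.sqrt (-t)) * (-1)) t :=
    (Real.hasDerivAt_sqrt (by linarith : -t ≠ 0)).comp t (hasDerivAt_neg t)
  have h2 := h1.const_mul c
  have e : c * (1 / (2 * Real.sqrt (-t)) * (-1)) = sqrtAmpDeriv c t := by
    simp only [sqrtAmpDeriv]
    ring
  rw [e] at h2
  exact h2

/-- THE FLOW `u(t, x) = c √(−t) ∇Γ(x)` — in similarity variables the STATIONARY profile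
`U(y) = c ∇Γ(y) = c y/(4π|y|³)` (`u = (−t)^{−1/2} U(x/√(−t))`; Serrin's `a(t)∇h` with `h = Γ`).
[cite: Serrin1962, the example u = a(t)∇h] -/
def dipoleFlow (c : ℝ) : ℝ → ℝ³ → ℝ³ := fun t x => sqrtAmp c t • dipole x

/-- Its pressure `p = −a'(t) Γ(x) − a(t)² |∇Γ(x)|²/2` (Bernoulli). [cite: Serrin1962, the example u = a(t)∇h] -/
def dipoleFlowPressure (c : ℝ) : ℝ → ℝ³ → ℝ :=
  fun t x => -(sqrtAmpDeriv c t) * newtonKernel x - (sqrtAmp c t) ^ 2 * (2⁻¹ * ‖dipole x‖ ^ 2)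

/-- `(t, x) ↦ a(t)` is smooth at points with `t < 0`. [folklore] -/
theorem contDiffAt_sqrtAmp_fst (c : ℝ) {z : ℝ × ℝ³} (hz : z.1 < 0) {n : WithTop ℕ∞} :
    ContDiffAt ℝ n (fun w : ℝ × ℝ³ => sqrtAmp c w.1) z :=
  contDiffAt_const.mul ((Real.contDiffAt_sqrt (by linarith : -z.1 ≠ 0)).comp z contDiffAt_fst.neg)

/-- `(t, x) ↦ a'(t)` is smooth at points with `t < 0`. [folklore] -/
theorem contDiffAt_sqrtAmpDeriv_fst (c : ℝ) {z : ℝ × ℝ³} (hz : z.1 < 0) {n : WithTop ℕ∞} :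
    ContDiffAt ℝ n (fun w : ℝ × ℝ³ => sqrtAmpDeriv c w.1) z := by
  have hs : ContDiffAt ℝ n (fun w : ℝ × ℝ³ => Real.sqrt (-w.1)) z :=
    (Real.contDiffAt_sqrt (by linarith : -z.1 ≠ 0)).comp z contDiffAt_fst.neg
  have hne : (2 * Real.sqrt (-z.1)) ≠ 0 := by
    have : 0 < Real.sqrt (-z.1) := Real.sqrt_pos.2 (by linarith)
    positivity
  exact (contDiffAt_const.div (contDiffAt_const.mul hs) hne).neg

/-- **The potential flow is a classical Navier–Stokes solution on the parabolic exterior** (indeed on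
`{t < 0} × (ℝ³ ∖ {0})`): `∂ₜu = a'∇Γ`, `(u·∇)u = a²∇(½|∇Γ|²)`, `Δu = 0`, `div u = 0`,
`∇p = −a'∇Γ − a²∇(½|∇Γ|²)`. [folklore] -/
theorem dipoleFlow_isClassical (c : ℝ) {R : ℝ} (hR : 0 ≤ R) :
    IsClassicalNSSolutionOnRegion (parabolicExterior R) 1 0 (dipoleFlow c) (dipoleFlowPressure c) := by
  rw [isClassicalNSSolutionOnRegion_iff_of_isOpen (isOpen_parabolicExterior R)]
  refine ⟨?_, ?_, ?_, ?_⟩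
  · intro z hz
    have hx : z.2 ≠ 0 := snd_ne_zero_of_mem_parabolicExterior hR hz
    exact ((contDiffAt_sqrtAmp_fst c hz.1).smul ((contDiffAt_dipole hx).comp z contDiffAt_snd)).contDiffWithinAt
  · intro z hz
    have hx : z.2 ≠ 0 := snd_ne_zero_of_mem_parabolicExterior hR hz
    have hdip : ContDiffAt ℝ ((⊤ : ℕ∞) : WithTop ℕ∞) (fun w : ℝ × ℝ³ => dipole w.2) z :=
      (contDiffAt_dipole hx).comp z contDiffAt_snd
    have hΓ : ContDiffAt ℝ ((⊤ : ℕ∞) : WithTop ℕ∞) (fun w : ℝ × ℝ³ => newtonKernel w.2) z :=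
      (contDiffAt_newtonKernel hx).comp z contDiffAt_snd
    exact (((contDiffAt_sqrtAmpDeriv_fst c hz.1).neg.mul hΓ).sub
      (((contDiffAt_sqrtAmp_fst c hz.1).pow 2).mul (contDiffAt_const.mul (hdip.norm_sq ℝ)))).contDiffWithinAt
  · intro t x hz
    have ht : t < 0 := hz.1
    have hx : x ≠ 0 := snd_ne_zero_of_mem_parabolicExterior hR hz
    obtain ⟨_, hΔ, hconv⟩ := dipole_identities hx
    have hdipd : DifferentiableAt ℝ dipole x := (contDiffAt_dipole hx (n := 1)).differentiableAt one_ne_zero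
    have hD : HasFDerivAt dipole (fderiv ℝ dipole x) x := hdipd.hasFDerivAt
    -- time derivative
    have h1 : deriv (fun s => dipoleFlow c s x) t = sqrtAmpDeriv c t • dipole x :=
      ((hasDerivAt_sqrtAmp c ht).smul_const (dipole x)).deriv
    -- convective term
    have h2 : convect (dipoleFlow c t) (dipoleFlow c t) x =
        (sqrtAmp c t * sqrtAmp c t) • gradient (fun y => 2⁻¹ * ‖dipole y‖ ^ 2) x := by
      rw [convect, show dipoleFlow c t = (sqrtAmp c t) • dipole from rfl, (hD.const_smul (sqrtAmp c t)).fderiv,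
        FunLike.coe_smul, Pi.smul_apply, Pi.smul_apply, map_smul, smul_smul, ← hconv,
        convect]
    -- viscous term
    have h3 : Δ (dipoleFlow c t) x = 0 := by
      show Δ ((sqrtAmp c t) • dipole) x = 0
      rw [InnerProductSpace.laplacian_smul _ (contDiffAt_dipole hx), hΔ, smul_zero]
    -- pressure gradient
    have hφd : DifferentiableAt ℝ (fun y => 2⁻¹ * ‖dipole y‖ ^ 2) x :=
      (hdipd.norm_sq ℝ).const_mul _
    have hΓd : HasFDerivAt newtonKernel (fderiv ℝ newtonKernel x) x :=
      (hasFDerivAt_newtonKernel hx).differentiableAt.hasFDerivAt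
    have hp : HasFDerivAt (dipoleFlowPressure c t)
        ((-(sqrtAmpDeriv c t)) • fderiv ℝ newtonKernel x -
          (sqrtAmp c t) ^ 2 • fderiv ℝ (fun y => 2⁻¹ * ‖dipole y‖ ^ 2) x) x :=
      (hΓd.const_mul (-(sqrtAmpDeriv c t))).sub (hφd.hasFDerivAt.const_mul ((sqrtAmp c t) ^ 2))
    have h4 : gradient (dipoleFlowPressure c t) x =
        (-(sqrtAmpDeriv c t)) • dipole x - (sqrtAmp c t) ^ 2 • gradient (fun y => 2⁻¹ * ‖dipole y‖ ^ 2) x := by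
      show (InnerProductSpace.toDual ℝ ℝ³).symm (fderiv ℝ (dipoleFlowPressure c t) x) = _
      rw [hp.fderiv, map_sub, map_smul, map_smul, ← gradient_newtonKernel hx]
      rfl
    rw [h1, h2, h3, h4]
    simp only [smul_zero, Pi.zero_apply, add_zero, zero_sub, neg_sub, neg_smul, sub_neg_eq_add, sq]
    abel
  · intro t x hz
    have hx : x ≠ 0 := snd_ne_zero_of_mem_parabolicExterior hR hz
    obtain ⟨hdiv, -, -⟩ := dipole_identities hx
    have hdipd : DifferentiableAt ℝ dipole x := (contDiffAt_dipole hx (n := 1)).differentiableAt one_ne_zero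
    rw [VectorCalculus.divergence, show dipoleFlow c t = (sqrtAmp c t) • dipole from rfl,
      (hdipd.hasFDerivAt.const_smul (sqrtAmp c t)).fderiv, ContinuousLinearMap.toLinearMap_smul, map_smul,
      ← VectorCalculus.divergence, hdiv, smul_zero]


/-- Hence a suitable weak solution on `Ω_R` (tree: classical ⇒ suitable). [folklore] -/
theorem dipoleFlow_isSuitable (c : ℝ) {R : ℝ} (hR : 0 ≤ R) :
    IsSuitableWeakSolutionOn (parabolicExteriorOpens R) 1 0 (dipoleFlow c) (dipoleFlowPressure c) :=
  (dipoleFlow_isClassical c hR).isSuitableWeakSolutionOn_of_subset one_pos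
    (Q := parabolicExteriorOpens R) (fun _ hz => hz)

/-- `c = 0` gives the zero flow. [folklore] -/
theorem dipoleFlow_zero : dipoleFlow 0 = fun _ _ => (0 : ℝ³) := by
  funext t x
  simp [dipoleFlow, sqrtAmp]

/-- `‖u(t, x)‖ = |c| √(−t) (4π|x|²)⁻¹` off the origin. [folklore] -/
theorem norm_dipoleFlow (c : ℝ) {t : ℝ} {x : ℝ³} (hx : x ≠ 0) :
    ‖dipoleFlow c t x‖ = |c| * Real.sqrt (-t) * (4 * Real.pi * ‖x‖ ^ 2)⁻¹ := by
  rw [dipoleFlow, norm_smul, norm_dipole hx, sqrtAmp, Real.norm_eq_abs, abs_mul,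
    abs_of_nonneg (Real.sqrt_nonneg _)]

/-- **Type I on the parabolic exterior**: for `R ≥ 1` and `(t, x) ∈ Ω_R`,
`‖u(t,x)‖ = |c|√(−t)/(4π|x|²) ≤ |c|/(|x| + √(−t))`, because `√(−t) < |x|` there and
`√(−t)(|x|+√(−t)) ≤ 2|x|² ≤ 4π|x|²`. So the Type-I constant of the witness is `|c|`, ARBITRARILY SMALL:
the exterior failure is not a large-data phenomenon (contrast: on the whole slab `C < ε₀` is vacuous by CKN).
[folklore] -/
theorem dipoleFlow_typeI_abs (c : ℝ) {R : ℝ} (hR : 1 ≤ R) :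
    ∀ z ∈ parabolicExterior R, ‖dipoleFlow c z.1 z.2‖ ≤ |c| / (‖z.2‖ + Real.sqrt (-z.1)) := by
  rintro ⟨t, x⟩ hz
  have ht : t < 0 := hz.1
  have hRx : R * Real.sqrt (-t) < ‖x‖ := hz.2
  have hx : x ≠ 0 := snd_ne_zero_of_mem_parabolicExterior (by linarith) hz
  set s := Real.sqrt (-t) with hs
  set n := ‖x‖ with hn
  have hs0 : 0 < s := Real.sqrt_pos.2 (by linarith)
  have hn0 : 0 < n := norm_pos_iff.2 hx
  have hsn : s ≤ n := by nlinarith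
  have hπ : (3 : ℝ) < Real.pi := Real.pi_gt_three
  show ‖dipoleFlow c t x‖ ≤ |c| / (n + s)
  rw [norm_dipoleFlow c hx, ← hn,
    show |c| * s * (4 * Real.pi * n ^ 2)⁻¹ = (|c| * s) / (4 * Real.pi * n ^ 2) by ring,
    div_le_div_iff₀ (by positivity) (by positivity)]
  have h1 : s * (n + s) ≤ 4 * Real.pi * n ^ 2 := by nlinarith
  calc |c| * s * (n + s) = |c| * (s * (n + s)) := by ring
    _ ≤ |c| * (4 * Real.pi * n ^ 2) := by gcongr

/-- In particular with `|c| ≤ 1` the Type-I constant `C = 1` works. [folklore] -/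
theorem dipoleFlow_typeI {c R : ℝ} (hc : |c| ≤ 1) (hR : 1 ≤ R) :
    ∀ z ∈ parabolicExterior R, ‖dipoleFlow c z.1 z.2‖ ≤ 1 / (‖z.2‖ + Real.sqrt (-z.1)) := by
  intro z hz
  refine (dipoleFlow_typeI_abs c hR z hz).trans ?_
  have hden : 0 < ‖z.2‖ + Real.sqrt (-z.1) :=
    add_pos_of_nonneg_of_pos (norm_nonneg _) (Real.sqrt_pos.2 (by linarith [hz.1]))
  exact div_le_div_of_nonneg_right hc hden.le

/-- The zero flow and the potential flow have the SAME SCAR: `‖u(t, x)‖ ≤ √δ/(4πρ²)` on `(−δ,0) × K`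
when `K ⊆ {‖x‖ ≥ ρ}`. [folklore] -/
theorem tendsto_eLpNorm_dipoleFlow (c : ℝ) : ∀ K : Set ℝ³, IsCompact K → (0 : ℝ³) ∉ K →
    Tendsto (fun δ : ℝ => eLpNorm (uncurry (dipoleFlow 0) - uncurry (dipoleFlow c)) ⊤
      (volume.restrict (Ioo (-δ) 0 ×ˢ K))) (𝓝[>] 0) (𝓝 0) := by
  intro K hK h0
  obtain ⟨ρ, hρ, hball⟩ := Metric.isOpen_iff.1 hK.isClosed.isOpen_compl 0 (mem_compl h0)
  have hmeas : ∀ δ : ℝ, MeasurableSet (Ioo (-δ) (0 : ℝ) ×ˢ K) := fun δ =>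
    measurableSet_Ioo.prod hK.isClosed.measurableSet
  have hbound : ∀ δ : ℝ, 0 < δ → eLpNorm (uncurry (dipoleFlow 0) - uncurry (dipoleFlow c)) ⊤
      (volume.restrict (Ioo (-δ) 0 ×ˢ K)) ≤
        ENNReal.ofReal (|c| * Real.sqrt δ * (4 * Real.pi * ρ ^ 2)⁻¹) := by
    intro δ hδ
    rw [eLpNorm_exponent_top]
    refine eLpNormEssSup_le_of_ae_bound ?_
    filter_upwards [ae_restrict_mem (hmeas δ)] with z hz
    obtain ⟨⟨hz1, hz2⟩, hzK⟩ := hz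
    have hnorm : ρ ≤ ‖z.2‖ := by
      by_contra hlt
      exact hball (mem_ball_zero_iff.2 (not_le.1 hlt)) hzK
    have hx : z.2 ≠ 0 := norm_pos_iff.1 (hρ.trans_le hnorm)
    have : (uncurry (dipoleFlow 0) - uncurry (dipoleFlow c)) z = -(dipoleFlow c z.1 z.2) := by
      simp [uncurry, dipoleFlow_zero]
    rw [this, norm_neg, norm_dipoleFlow c hx]
    have hsqrt : Real.sqrt (-z.1) ≤ Real.sqrt δ := Real.sqrt_le_sqrt (by linarith)
    have hπ : (3 : ℝ) < Real.pi := Real.pi_gt_three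
    gcongr
  have hup : Tendsto (fun δ : ℝ => ENNReal.ofReal (|c| * Real.sqrt δ * (4 * Real.pi * ρ ^ 2)⁻¹))
      (𝓝[>] 0) (𝓝 0) := by
    have h0 : Tendsto (fun δ : ℝ => |c| * Real.sqrt δ * (4 * Real.pi * ρ ^ 2)⁻¹) (𝓝 0) (𝓝 0) := by
      have := ((Real.continuous_sqrt.tendsto (0 : ℝ)).const_mul |c|).mul_const (4 * Real.pi * ρ ^ 2)⁻¹
      simpa using this
    simpa using (ENNReal.tendsto_ofReal h0).mono_left nhdsWithin_le_nhds
  refine tendsto_of_tendsto_of_tendsto_of_le_of_le' tendsto_const_nhds hup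
    (Eventually.of_forall fun δ => zero_le) ?_
  filter_upwards [self_mem_nhdsWithin] with δ hδ
  exact hbound δ hδ

/-- The potential flow with `c ≠ 0` vanishes nowhere on `Ω_R`. [folklore] -/
theorem dipoleFlow_ne_zero {c R : ℝ} (hc : c ≠ 0) (hR : 0 ≤ R) {z : ℝ × ℝ³} (hz : z ∈ parabolicExterior R) :
    dipoleFlow c z.1 z.2 ≠ 0 := by
  have hx : z.2 ≠ 0 := snd_ne_zero_of_mem_parabolicExterior hR hz
  have ha : sqrtAmp c z.1 ≠ 0 := by
    have : 0 < Real.sqrt (-z.1) := Real.sqrt_pos.2 (by linarith [hz.1])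
    exact mul_ne_zero hc this.ne'
  exact smul_ne_zero ha (dipole_ne_zero hx)

/-- **Backward NON-uniqueness from the scar on the parabolic exterior, with the Type-I bound and no smallness
threshold**: for every `R ≥ 1` and every `C > 0`, `u₁ = 0` and `u₂ = dipoleFlow C = C√(−t)∇Γ(x)` are suitable weak
solutions of Navier–Stokes on `Ω_R`, with weak spatial gradients, both obeying `‖u(t,x)‖ ≤ C/(‖x‖ + √(−t))` there,
with the same final-time trace off the origin (zero), and NOT a.e. equal on `Ω_R`. [folklore] -/
theorem exists_sameScar_typeI_not_aeEq_parabolicExterior {R C : ℝ} (hR : 1 ≤ R) (hC : 0 < C) :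
    ∃ (u₁ u₂ : ℝ → ℝ³ → ℝ³) (p₁ p₂ : ℝ → ℝ³ → ℝ) (G₁ G₂ : ℝ → ℝ³ → ℝ³ →L[ℝ] ℝ³),
      IsSuitableWeakSolutionOn (parabolicExteriorOpens R) 1 0 u₁ p₁ ∧
      HasWeakSpatialGradientOn (parabolicExteriorOpens R) u₁ G₁ ∧
      (∀ z ∈ parabolicExterior R, ‖u₁ z.1 z.2‖ ≤ C / (‖z.2‖ + Real.sqrt (-z.1))) ∧
      IsSuitableWeakSolutionOn (parabolicExteriorOpens R) 1 0 u₂ p₂ ∧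
      HasWeakSpatialGradientOn (parabolicExteriorOpens R) u₂ G₂ ∧
      (∀ z ∈ parabolicExterior R, ‖u₂ z.1 z.2‖ ≤ C / (‖z.2‖ + Real.sqrt (-z.1))) ∧
      (∀ K : Set ℝ³, IsCompact K → (0 : ℝ³) ∉ K →
        Tendsto (fun δ : ℝ => eLpNorm (uncurry u₁ - uncurry u₂) ⊤
          (volume.restrict (Ioo (-δ) 0 ×ˢ K))) (𝓝[>] 0) (𝓝 0)) ∧
      ¬ (uncurry u₁ =ᵐ[volume.restrict (parabolicExterior R)] uncurry u₂) := by
  have hR0 : 0 ≤ R := by linarith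
  obtain ⟨G₁, hG₁, -, -⟩ := (dipoleFlow_isSuitable 0 hR0).localEnergy
  obtain ⟨G₂, hG₂, -, -⟩ := (dipoleFlow_isSuitable C hR0).localEnergy
  have h0 : ∀ z ∈ parabolicExterior R, ‖dipoleFlow 0 z.1 z.2‖ ≤ C / (‖z.2‖ + Real.sqrt (-z.1)) := by
    intro z hz
    have hden : 0 < ‖z.2‖ + Real.sqrt (-z.1) :=
      add_pos_of_nonneg_of_pos (norm_nonneg _) (Real.sqrt_pos.2 (by linarith [hz.1]))
    rw [dipoleFlow_zero, norm_zero]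
    positivity
  have hCw : ∀ z ∈ parabolicExterior R, ‖dipoleFlow C z.1 z.2‖ ≤ C / (‖z.2‖ + Real.sqrt (-z.1)) := by
    intro z hz
    simpa [abs_of_pos hC] using dipoleFlow_typeI_abs C hR z hz
  refine ⟨_, _, _, _, G₁, G₂, dipoleFlow_isSuitable 0 hR0, hG₁, h0, dipoleFlow_isSuitable C hR0, hG₂, hCw,
    tendsto_eLpNorm_dipoleFlow C, ?_⟩
  refine not_aeEq_restrict_of_ne_on_open (isOpen_parabolicExterior R) (parabolicExterior_nonempty R)
    subset_rfl (fun z hz => ?_)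
  have h2 := dipoleFlow_ne_zero hC.ne' hR0 hz
  simp only [uncurry, dipoleFlow_zero, ne_eq]
  exact fun h' => h2 h'.symm

end Literature.Analysis.FluidPDE

end
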